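import Summits.HodgeConjecture.CorCM.Census.QuarticInversionKeyLemma

/-!
# The quartic inversion twists, X: indicator labels and the values of the functionals on the equator-crossing squares

COR-CM (cell `pub-hodgecm2`, stage 2 of the Hodge ladder), count-neutral KERNEL COMBINATORICS by the binder seat b23 (gen 44; claim
QUARTIC-INVERSION, HOME/INBOX.md l.12829).  Part X of the lane `Census/QuarticInversion*`, on top of parts I–IX and seat b09's slice (`ind`,
`ind_add_delta_of_not_mem`, `wt_ind`), all BY NAME.  Bookkeeping definitions with bodies (`kb`, `indLab`, `sqFace`) + theorems; no `Prop`-valued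
definition, no `decide` beyond closed identities in `ZMod 2`/`Bool`, no certificate, no named fact, no geometry, no `sorry`.  `Interfaces.lean` (C1),
every E term, B01, `Transposition/*`, `PortJoin/*` untouched.
HONEST FRAMING: `HC_CM` is NOT proved, here or anywhere in the tree; nothing here is a period, a count of record or a headline.

CONTENT (`|B| = 2K + 1`).  The closing faces of the lane cross the weight equator in coordinate `0`.
* §1 **Indicator labels** `indLab Q b = ((𝟙_Q, κ(b 1)), (κ(b 2), κ(b 3)))` — coordinate `0` the indicator of `Q ⊆ B`, the other three the
  constants `κ true = 0` (low) and `κ false = 𝟙` (up) prescribed by their halves `b`; their flips in coordinate `0` (`insert`), conjugates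
  (`Qᶜ`, `!b`), and **the weights of part VII on them**: `wA 0 η s (indLab Q b) = [η = b off 0]·[|Q| > K]·[s ∉ Q]`, `wA j η s (indLab Q b) = 0` for
  `j ≠ 0` (a constant is never up with a zero bit), `wC η (indLab Q b) = [η 0 = (|Q| ≤ K)]·[η = b off 0]`.
* §2 **The equator-crossing square** `sqFace P u₁ u₂ b = faceVec₄ (indLab P b) (0,u₁) (0,u₂)` with `|P| = K − 1`, `u₁ ≠ u₂ ∉ P` (corners of weights
  `K−1, K, K, K+1` in coordinate `0`: the dicyclic lane's closing shape `f₁` over a constant background) and ITS FUNCTIONAL VALUES: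
  **`fnl (wA 0 η s) (sqFace) = [η = b off 0]·[s ∉ P ∪ {u₁,u₂}] + [η = !b off 0]·[s ∈ P ∪ {u₁,u₂}]`** (`fnl_wA_zero_sqFace`),
  `fnl (wA j η s) (sqFace) = 0` for `j ≠ 0` (`fnl_wA_ne_sqFace`), and
  **`fnl (wC η) (sqFace) = [η 0 = false] · ([η = b off 0] + [η = !b off 0]) − [η 0 = true] · ([η = b off 0] + [η = !b off 0])`** (`fnl_wC_sqFace`).
Part XI does the same for the mixed closing faces; parts XII–XIII generate the value lattice from these.  All [folklore].

## References
* [Pohlmann1968] H. Pohlmann, Algebraic cycles on abelian varieties of complex multiplication type, Ann. of Math. 88 (1968), Thm 1.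
-/

namespace Summit.HodgeConjecture.CorCM.Census.QuarticInversion

open Finset
open Summit.HodgeConjecture.CorCM.Census.OddSliceFacesModel
open Summit.HodgeConjecture.CorCM.Census.OddSliceFacesSquares (clsTy)
open Summit.HodgeConjecture.CorCM.Census.DicyclicTwist (Ty₂)

noncomputable section

variable (A : Type) [Fintype A] [DecidableEq A]

/-! ## §1 Indicator labels and the weights on them -/

/-- The constant slice label with prescribed half: `κ true = 0`, `κ false = 𝟙`. [folklore] -/
def kb (x : Bool) : Ty A := if x then 0 else 1

omit [DecidableEq A] in
/-- `half (κ x) = x` (`|B| ≥ 1`). [folklore] -/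
theorem half_kb (h1 : 1 ≤ Fintype.card A) (x : Bool) : half A (kb A x) = x := by
  cases x
  · show half A 1 = false; exact half_one A h1
  · show half A 0 = true; exact half_zero' A

omit [Fintype A] [DecidableEq A] in
/-- The bits of `κ x`: `κ x s = 0 ↔ x = true`. [folklore] -/
theorem kb_apply_eq_zero_iff (x : Bool) (s : A) : kb A x s = 0 ↔ x = true := by
  cases x
  · show (1 : Ty A) s = 0 ↔ _; simp
  · show (0 : Ty A) s = 0 ↔ _; simp

omit [Fintype A] [DecidableEq A] in
/-- `κ x + 1 = κ (!x)`. [folklore] -/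
theorem kb_add_one (x : Bool) : kb A x + 1 = kb A (!x) := by
  cases x
  · show (1 : Ty A) + 1 = 0
    have h := add_one_add_one A (0 : Ty A); rwa [zero_add] at h
  · show (0 : Ty A) + 1 = 1; rw [zero_add]

/-- `𝟙_Q + 1 = 𝟙_{Qᶜ}`. [folklore] -/
theorem ind_add_one (Q : Finset A) : ind A Q + 1 = ind A Qᶜ := by
  funext s
  simp only [Pi.add_apply, ind, Pi.one_apply, Finset.mem_compl]
  by_cases hs : s ∈ Q
  · rw [if_pos hs, if_neg (not_not.mpr hs)]; decide
  · rw [if_neg hs, if_pos hs, zero_add]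

omit [Fintype A] in
/-- The bits of an indicator: `𝟙_Q s = 0 ↔ s ∉ Q`. [folklore] -/
theorem ind_apply_eq_zero_iff (Q : Finset A) (s : A) : ind A Q s = 0 ↔ s ∉ Q := by
  unfold ind; by_cases hs : s ∈ Q <;> simp [hs]

/-- The half of an indicator label. [folklore] -/
theorem half_ind (Q : Finset A) : half A (ind A Q) = decide (Q.card ≤ Fintype.card A / 2) := by
  unfold half; rw [wt_ind]

/-- **The indicator label** `((𝟙_Q, κ(b 1)), (κ(b 2), κ(b 3)))`. [folklore] -/
def indLab (Q : Finset A) (b : Fin 4 → Bool) : Ty₄ A := ((ind A Q, kb A (b 1)), (kb A (b 2), kb A (b 3)))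

omit [Fintype A] in
/-- Coordinate `0` of an indicator label. [folklore] -/
@[simp] theorem coord_zero_indLab (Q : Finset A) (b : Fin 4 → Bool) : coord A 0 (indLab A Q b) = ind A Q := rfl

omit [Fintype A] in
/-- The constant coordinates of an indicator label. [folklore] -/
theorem coord_indLab_of_ne (Q : Finset A) (b : Fin 4 → Bool) {j : Fin 4} (hj : j ≠ 0) : coord A j (indLab A Q b) = kb A (b j) := by
  fin_cases j
  · exact absurd rfl hj
  all_goals rfl

omit [Fintype A] in
/-- A flip in coordinate `0` at a non-member adjoins it. [folklore] -/
theorem flipAt_zero_indLab {Q : Finset A} {u : A} (hu : u ∉ Q) (b : Fin 4 → Bool) :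
    flipAt A (0, u) (indLab A Q b) = indLab A (insert u Q) b := by
  show addAt A 0 (δ A u) (indLab A Q b) = _
  rw [addAt_zero]
  unfold indLab
  rw [ind_add_delta_of_not_mem A hu]

/-- The conjugate of an indicator label. [folklore] -/
theorem conj₄_indLab (Q : Finset A) (b : Fin 4 → Bool) : conj₄ A (indLab A Q b) = indLab A Qᶜ (fun i => !b i) := by
  refine ext_coord A fun k => ?_
  rw [coord_conj₄]
  fin_cases k
  · exact ind_add_one A Q
  all_goals exact kb_add_one A _

/-- The matching condition of `wA 0` / `wC` on an indicator label. [folklore] -/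
theorem match_indLab_iff (h1 : 1 ≤ Fintype.card A) (Q : Finset A) (b η : Fin 4 → Bool) :
    (∀ i, i ≠ (0 : Fin 4) → half A (coord A i (indLab A Q b)) = η i) ↔ (∀ i, i ≠ (0 : Fin 4) → η i = b i) := by
  constructor
  · intro h i hi; have := h i hi; rw [coord_indLab_of_ne A Q b hi, half_kb A h1] at this; exact this.symm
  · intro h i hi; rw [coord_indLab_of_ne A Q b hi, half_kb A h1]; exact (h i hi).symm

/-- **The atom weights on an indicator label, coordinate `0`.** [folklore] -/
theorem wA_zero_indLab (h1 : 1 ≤ Fintype.card A) (η : Fin 4 → Bool) (s : A) (Q : Finset A) (b : Fin 4 → Bool) :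
    wA A 0 η s (indLab A Q b) =
      if (∀ i, i ≠ (0 : Fin 4) → η i = b i) ∧ ¬ Q.card ≤ Fintype.card A / 2 ∧ s ∉ Q then 1 else 0 := by
  have hm := match_indLab_iff A h1 Q b η
  have hup : (half A (coord A 0 (indLab A Q b)) = false) ↔ ¬ Q.card ≤ Fintype.card A / 2 := by
    rw [coord_zero_indLab, half_ind]; simp
  have hbit : (coord A 0 (indLab A Q b) s = 0) ↔ s ∉ Q := by rw [coord_zero_indLab, ind_apply_eq_zero_iff]
  simp only [wA, wMatch, wUp, hm, hup, hbit]
  by_cases c1 : ∀ i, i ≠ (0 : Fin 4) → η i = b i <;> by_cases c2 : Q.card ≤ Fintype.card A / 2 <;> by_cases c3 : s ∈ Q <;>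
    simp [c1, c2, c3]

/-- **The atom weights on an indicator label vanish in the constant coordinates.** [folklore] -/
theorem wA_ne_indLab (h1 : 1 ≤ Fintype.card A) {j : Fin 4} (hj : j ≠ 0) (η : Fin 4 → Bool) (s : A) (Q : Finset A) (b : Fin 4 → Bool) :
    wA A j η s (indLab A Q b) = 0 := by
  have hup : half A (coord A j (indLab A Q b)) = b j := by rw [coord_indLab_of_ne A Q b hj, half_kb A h1]
  have hbit : (coord A j (indLab A Q b) s = 0) ↔ b j = true := by rw [coord_indLab_of_ne A Q b hj, kb_apply_eq_zero_iff]
  unfold wA wUp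
  cases hb : b j
  · rw [hb] at hbit; simp [hbit]
  · rw [hb] at hup; simp [hup]

/-- **The constant weights on an indicator label.** [folklore] -/
theorem wC_indLab (h1 : 1 ≤ Fintype.card A) (η : Fin 4 → Bool) (Q : Finset A) (b : Fin 4 → Bool) :
    wC A η (indLab A Q b) =
      if η 0 = decide (Q.card ≤ Fintype.card A / 2) ∧ ∀ i, i ≠ (0 : Fin 4) → η i = b i then 1 else 0 := by
  have key : (∀ i, half A (coord A i (indLab A Q b)) = η i) ↔
      (η 0 = decide (Q.card ≤ Fintype.card A / 2) ∧ ∀ i, i ≠ (0 : Fin 4) → η i = b i) := by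
    rw [← match_indLab_iff A h1 Q b η]
    constructor
    · intro h
      refine ⟨?_, fun i hi => h i⟩
      have := h 0; rw [coord_zero_indLab, half_ind] at this; exact this.symm
    · rintro ⟨h0, h⟩ i
      by_cases hi : i = 0
      · rw [hi, coord_zero_indLab, half_ind]; exact h0.symm
      · exact h i hi
  unfold wC
  by_cases c : (∀ i, half A (coord A i (indLab A Q b)) = η i)
  · rw [if_pos c, if_pos (key.mp c)]
  · rw [if_neg c, if_neg (fun h => c (key.mpr h))]

/-! ## §2 The equator-crossing square and its functional values -/

/-- **The closing square** through `indLab P b` at the places `(0,u₁), (0,u₂)`. [folklore] -/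
def sqFace (P : Finset A) (u₁ u₂ : A) (b : Fin 4 → Bool) : Ty₄ A → ℤ := faceVec₄ A (indLab A P b) (0, u₁) (0, u₂)

omit [Fintype A] in
/-- The double flip of the closing square. [folklore] -/
theorem flipAt_flipAt_indLab {P : Finset A} {u₁ u₂ : A} (h1 : u₁ ∉ P) (h2 : u₂ ∉ P) (h12 : u₁ ≠ u₂) (b : Fin 4 → Bool) :
    flipAt A (0, u₁) (flipAt A (0, u₂) (indLab A P b)) = indLab A (insert u₁ (insert u₂ P)) b := by
  have h1' : u₁ ∉ insert u₂ P := by rw [Finset.mem_insert]; push Not; exact ⟨h12, h1⟩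
  rw [flipAt_zero_indLab A h2, flipAt_zero_indLab A h1']

omit [Fintype A] in
/-- The signed square of a weight at the closing square. [folklore] -/
theorem sq_indLab (w : Ty₄ A → ℤ) {P : Finset A} {u₁ u₂ : A} (h1 : u₁ ∉ P) (h2 : u₂ ∉ P) (h12 : u₁ ≠ u₂) (b : Fin 4 → Bool) :
    sq A w (indLab A P b) (0, u₁) (0, u₂) =
      w (indLab A P b) - w (indLab A (insert u₁ P) b) - w (indLab A (insert u₂ P) b) + w (indLab A (insert u₁ (insert u₂ P)) b) := by
  rw [sq, flipAt_flipAt_indLab A h1 h2 h12, flipAt_zero_indLab A h1, flipAt_zero_indLab A h2]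

/-- The signed square of a weight at the conjugate of the closing square. [folklore] -/
theorem sq_conj_indLab (w : Ty₄ A → ℤ) {P : Finset A} {u₁ u₂ : A} (h1 : u₁ ∉ P) (h2 : u₂ ∉ P) (h12 : u₁ ≠ u₂) (b : Fin 4 → Bool) :
    sq A w (conj₄ A (indLab A P b)) (0, u₁) (0, u₂) =
      w (indLab A Pᶜ (fun i => !b i)) - w (indLab A (insert u₁ P)ᶜ (fun i => !b i)) - w (indLab A (insert u₂ P)ᶜ (fun i => !b i)) +
        w (indLab A (insert u₁ (insert u₂ P))ᶜ (fun i => !b i)) := by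
  rw [sq, ← conj₄_flipAt, ← conj₄_flipAt, ← conj₄_flipAt, flipAt_flipAt_indLab A h1 h2 h12, flipAt_zero_indLab A h1,
    flipAt_zero_indLab A h2]
  simp only [conj₄_indLab]

/-- The cardinalities along the square (`|P| + 1 = K`, `|B| = 2K + 1`). [folklore] -/
theorem cards_sqFace {P : Finset A} {u₁ u₂ : A} (h1 : u₁ ∉ P) (h2 : u₂ ∉ P) (h12 : u₁ ≠ u₂) (hA : Odd (Fintype.card A))
    (hP : P.card + 1 = Fintype.card A / 2) :
    (P.card ≤ Fintype.card A / 2) ∧ ((insert u₁ P).card ≤ Fintype.card A / 2) ∧ ((insert u₂ P).card ≤ Fintype.card A / 2) ∧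
      ¬ ((insert u₁ (insert u₂ P)).card ≤ Fintype.card A / 2) ∧ ¬ (Pᶜ.card ≤ Fintype.card A / 2) ∧
      ¬ ((insert u₁ P)ᶜ.card ≤ Fintype.card A / 2) ∧ ¬ ((insert u₂ P)ᶜ.card ≤ Fintype.card A / 2) ∧
      ((insert u₁ (insert u₂ P))ᶜ.card ≤ Fintype.card A / 2) := by
  have c1 : (insert u₁ P).card = P.card + 1 := Finset.card_insert_of_notMem h1
  have c2 : (insert u₂ P).card = P.card + 1 := Finset.card_insert_of_notMem h2
  have c12 : (insert u₁ (insert u₂ P)).card = P.card + 2 := by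
    rw [Finset.card_insert_of_notMem (by rw [Finset.mem_insert]; push Not; exact ⟨h12, h1⟩), c2]
  have cc : ∀ Q : Finset A, Qᶜ.card = Fintype.card A - Q.card := fun Q => Finset.card_compl Q
  obtain ⟨j, hj⟩ := hA
  rw [cc, cc, cc, cc, c1, c2, c12]
  omega

omit [Fintype A] in
/-- Membership bookkeeping along the square: `[s ∈ P+u₁] + [s ∈ P+u₂] − [s ∈ P] = [s ∈ P+u₁+u₂]`. [folklore] -/
theorem memb_ident {P : Finset A} {u₁ u₂ : A} (h1 : u₁ ∉ P) (h2 : u₂ ∉ P) (h12 : u₁ ≠ u₂) (s : A) :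
    ((if s ∈ insert u₁ P then (1 : ℤ) else 0) + (if s ∈ insert u₂ P then 1 else 0) - (if s ∈ P then 1 else 0)) =
      if s ∈ insert u₁ (insert u₂ P) then 1 else 0 := by
  simp only [Finset.mem_insert]
  by_cases hsP : s ∈ P
  · have hs1 : s ≠ u₁ := fun h => h1 (h ▸ hsP)
    have hs2 : s ≠ u₂ := fun h => h2 (h ▸ hsP)
    simp [hsP, hs1, hs2]
  · by_cases hs1 : s = u₁
    · subst hs1; simp [hsP, h12]
    · by_cases hs2 : s = u₂
      · subst hs2; simp [hsP, hs1]
      · simp [hsP, hs1, hs2]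

/-- **Values of the coordinate-`0` atom functionals on the closing square**:
`[η = b off 0]·[s ∉ P ∪ {u₁,u₂}] + [η = !b off 0]·[s ∈ P ∪ {u₁,u₂}]`. [folklore] -/
theorem fnl_wA_zero_sqFace (hA : Odd (Fintype.card A)) {P : Finset A} {u₁ u₂ : A} (h1 : u₁ ∉ P) (h2 : u₂ ∉ P) (h12 : u₁ ≠ u₂)
    (hP : P.card + 1 = Fintype.card A / 2) (η : Fin 4 → Bool) (s : A) (b : Fin 4 → Bool) :
    fnl A (wA A 0 η s) (sqFace A P u₁ u₂ b) =
      (if (∀ i, i ≠ (0 : Fin 4) → η i = b i) ∧ s ∉ insert u₁ (insert u₂ P) then 1 else 0) +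
      (if (∀ i, i ≠ (0 : Fin 4) → η i = !b i) ∧ s ∈ insert u₁ (insert u₂ P) then 1 else 0) := by
  have hA1 : 1 ≤ Fintype.card A := by obtain ⟨j, hj⟩ := hA; omega
  obtain ⟨cP, c1, c2, c12, cPc, c1c, c2c, c12c⟩ := cards_sqFace A h1 h2 h12 hA hP
  rw [sqFace, fnl_faceVec₄, sq_indLab A _ h1 h2 h12, sq_conj_indLab A _ h1 h2 h12]
  have hm := memb_ident A h1 h2 h12 s
  by_cases hb : (∀ i, i ≠ (0 : Fin 4) → η i = b i) <;> by_cases hnb : (∀ i, i ≠ (0 : Fin 4) → η i = !b i)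
  · exfalso; have := (hb 1 (by decide)).symm.trans (hnb 1 (by decide)); cases b 1 <;> simp at this
  · have hbT : (∀ i, i ≠ (0 : Fin 4) → η i = b i) ↔ True := iff_true_intro hb
    have hnbF : (∀ i, i ≠ (0 : Fin 4) → η i = !b i) ↔ False := iff_false_intro hnb
    simp only [wA_zero_indLab A hA1, cP, c1, c2, c12, cPc, c1c, c2c, c12c, hbT, hnbF, not_true_eq_false, not_false_eq_true,
      true_and, false_and, if_false, Finset.mem_compl, not_not, sub_zero, add_zero, sub_self, zero_add]
  · have hbF : (∀ i, i ≠ (0 : Fin 4) → η i = b i) ↔ False := iff_false_intro hb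
    have hnbT : (∀ i, i ≠ (0 : Fin 4) → η i = !b i) ↔ True := iff_true_intro hnb
    simp only [wA_zero_indLab A hA1, cP, c1, c2, c12, cPc, c1c, c2c, c12c, hbF, hnbT, not_true_eq_false, not_false_eq_true,
      true_and, false_and, if_false, Finset.mem_compl, not_not, sub_zero, add_zero, zero_sub, zero_add, and_false]
    rw [← hm]; ring
  · have hbF : (∀ i, i ≠ (0 : Fin 4) → η i = b i) ↔ False := iff_false_intro hb
    have hnbF : (∀ i, i ≠ (0 : Fin 4) → η i = !b i) ↔ False := iff_false_intro hnb
    simp only [wA_zero_indLab A hA1, hbF, hnbF, false_and, if_false, add_zero, sub_self]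

/-- **The atom functionals of the constant coordinates vanish on the closing square.** [folklore] -/
theorem fnl_wA_ne_sqFace (hA : Odd (Fintype.card A)) {j : Fin 4} (hj : j ≠ 0) (η : Fin 4 → Bool) (s : A) {P : Finset A} {u₁ u₂ : A}
    (h1 : u₁ ∉ P) (h2 : u₂ ∉ P) (h12 : u₁ ≠ u₂) (b : Fin 4 → Bool) : fnl A (wA A j η s) (sqFace A P u₁ u₂ b) = 0 := by
  have hA1 : 1 ≤ Fintype.card A := by obtain ⟨k, hk⟩ := hA; omega
  rw [sqFace, fnl_faceVec₄, sq_indLab A _ h1 h2 h12, sq_conj_indLab A _ h1 h2 h12]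
  simp only [wA_ne_indLab A hA1 hj, add_zero, sub_self]

/-- **Values of the constant functionals on the closing square** (patterns written `(η 0, η off 0)`):
`[η = (false, b)] − [η = (true, b)] + [η = (false, !b)] − [η = (true, !b)]`. [folklore] -/
theorem fnl_wC_sqFace (hA : Odd (Fintype.card A)) {P : Finset A} {u₁ u₂ : A} (h1 : u₁ ∉ P) (h2 : u₂ ∉ P) (h12 : u₁ ≠ u₂)
    (hP : P.card + 1 = Fintype.card A / 2) (η : Fin 4 → Bool) (b : Fin 4 → Bool) :
    fnl A (wC A η) (sqFace A P u₁ u₂ b) =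
      (if η 0 = false ∧ ∀ i, i ≠ (0 : Fin 4) → η i = b i then 1 else 0) - (if η 0 = true ∧ ∀ i, i ≠ (0 : Fin 4) → η i = b i then 1 else 0) +
      (if η 0 = false ∧ ∀ i, i ≠ (0 : Fin 4) → η i = !b i then 1 else 0) -
      (if η 0 = true ∧ ∀ i, i ≠ (0 : Fin 4) → η i = !b i then 1 else 0) := by
  have hA1 : 1 ≤ Fintype.card A := by obtain ⟨j, hj⟩ := hA; omega
  obtain ⟨cP, c1, c2, c12, cPc, c1c, c2c, c12c⟩ := cards_sqFace A h1 h2 h12 hA hP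
  rw [sqFace, fnl_faceVec₄, sq_indLab A _ h1 h2 h12, sq_conj_indLab A _ h1 h2 h12]
  simp only [wC_indLab A hA1, cP, c1, c2, c12, cPc, c1c, c2c, c12c, decide_true, decide_false]
  cases η 0 <;> by_cases hb : (∀ i, i ≠ (0 : Fin 4) → η i = b i) <;> by_cases hnb : (∀ i, i ≠ (0 : Fin 4) → η i = !b i) <;>
    simp [hb, hnb]

end

end Summit.HodgeConjecture.CorCM.Census.QuarticInversion
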